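import Summits.CriticalPhenomena.PercolationContinuityZ3.Theorems.PercNearOneGluingNoHeavyLowerTailSahiClassTCoreReduction
import Summits.CriticalPhenomena.PercolationContinuityZ3.Theorems.PercNearOneGluingNoHeavyLowerTailSahiTransportJRFour
import Mathlib.Tactic.Linarith
import HarnessLib

/-!
# `NoHeavyLowerTail` (crux stmt-CriticalPhenomena-4575), P2 — the open core, IV (COMPUTATIONAL): **every member of an open-core triple is essential on at least
# FIVE coordinates**

Support file (seat `prim-masterthm-p2`, gen 14; `--supports stmt-CriticalPhenomena-4575`; proposed `--computational`: P3's junta-slot theorem with four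
coordinates `SahiTransportJR.sahiE_three_nonneg_of_determinedBy_card_le_four` has `native_decide` certificate evaluations in its axiom closure; nothing else
non-standard, no `sorry`).

* **`masterFamilyNonneg_three_iff_core_five`** — Kahn's Conjecture 5 (`MasterFamilyNonneg 3`) ⟺ `C_3` for CORE triples (a coordinate essential to all three members,
  no canalyzing and no private essential coordinate) in which EVERY member has at least five essential coordinates.  In particular the twisted `(2,2,2)` triple,
  the `K₄` perfect matchings and every triple with a member on `≤ 4` coordinates are OUTSIDE the open core. [this work]
-/

noncomputable section

open scoped Classical

namespace Summit.CriticalPhenomena.PercolationContinuityZ3.Theorems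

namespace SahiClassTCube

open Finset Function
open Literature.Combinatorics.Sahi2008
open Literature.Probability.Percolation.DecisionTree (ind)

variable {κ : Type} [Fintype κ]

/-- A member with at most four essential coordinates settles `C_3` for the triple (P3's computational junta slot, any slot by symmetry). [this work] -/
theorem sahiE_three_nonneg_of_card_esupp_le_four (p : κ → unitInterval) (U : Fin 3 → Set (Set κ)) (hU : ∀ j, IsUpperSet (U j))
    {j : Fin 3} (hj : (esupp (U j)).card ≤ 4) : 0 ≤ sahiE (bernoulliWeight p) 3 (fun i => ind (U i)) := by
  let σ : Equiv.Perm (Fin 3) := Equiv.swap 0 j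
  have e0 : σ 0 = j := Equiv.swap_apply_left 0 j
  rw [← sahiE_three_ind_comp_perm (bernoulliWeight p) σ U]
  have hj' : (esupp (U (σ 0))).card ≤ 4 := by rw [e0]; exact hj
  have h' := SahiTransportJR.sahiE_three_nonneg_of_determinedBy_card_le_four p (esupp (U (σ 0))) hj'
    (determinedBy_esupp (hU (σ 0))) (hU (σ 0)) (hU (σ 1)) (hU (σ 2))
  rw [← Pointwise.ind_vec3, vec3_eta (fun i => U (σ i))] at h'
  exact h'

/-- **THE OPEN CORE HAS MEMBERS WITH ≥ 5 ESSENTIAL COORDINATES (computational).**  `MasterFamilyNonneg 3` (⟺ `KahnConjecture`) ⟺ `C_3` for core triples all of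
whose members have at least five essential coordinates. [this work] -/
theorem masterFamilyNonneg_three_iff_core_five :
    MasterFamilyNonneg 3 ↔
      ∀ (κ : Type) [Fintype κ] (p : κ → unitInterval) (U : Fin 3 → Set (Set κ)), (∀ j, IsUpperSet (U j)) →
        (∃ x, x ∈ esupp (U 0) ∧ x ∈ esupp (U 1) ∧ x ∈ esupp (U 2)) →
        (∀ j x, x ∈ esupp (U j) → ¬ ({ω : Set κ | x ∈ ω} ⊆ U j) ∧ ¬ (U j ⊆ {ω : Set κ | x ∈ ω})) →
        (∀ j x, x ∈ esupp (U j) → ∃ j', j' ≠ j ∧ x ∈ esupp (U j')) →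
        (∀ j, 5 ≤ (esupp (U j)).card) →
        0 ≤ sahiE (bernoulliWeight p) 3 (fun j => ind (U j)) := by
  rw [masterFamilyNonneg_three_iff_core]
  constructor
  · intro h κ _ p U hU h1 h2 h3 _
    exact h κ p U hU h1 h2 h3
  · intro h κ _ p U hU h1 h2 h3
    by_cases hsmall : ∃ j, (esupp (U j)).card ≤ 4
    · obtain ⟨j, hj⟩ := hsmall
      exact sahiE_three_nonneg_of_card_esupp_le_four p U hU hj
    · push Not at hsmall
      exact h κ p U hU h1 h2 h3 fun j => by have := hsmall j; omega

end SahiClassTCube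

end Summit.CriticalPhenomena.PercolationContinuityZ3.Theorems
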